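import Mathlib.Analysis.Calculus.InverseFunctionTheorem.FDeriv
import Mathlib.Analysis.Calculus.FDeriv.Mul
import Mathlib.Analysis.Calculus.FDeriv.Prod
import Mathlib.Analysis.Calculus.Deriv.Comp
import Mathlib.Analysis.SpecialFunctions.ExpDeriv
import Mathlib.Algebra.MvPolynomial.PDeriv
import Mathlib.Algebra.MvPolynomial.Cardinal
import Mathlib.SetTheory.Cardinal.Subfield
import Mathlib.Topology.Compactness.Lindelof
import Mathlib.Topology.DiscreteSubset
import Mathlib.LinearAlgebra.Determinant
import Mathlib.Topology.Algebra.Module.FiniteDimension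
import Mathlib.Analysis.Complex.Cardinality
import Literature.NumberTheory.Transcendental.ZilberField
import Literature.NumberTheory.Transcendental.EclPregeometryProofs
import Literature.NumberTheory.Transcendental.EclClosureOperatorProofs
import HarnessLib

/-!
# The countable closure property of `ℂ_exp` (proof)

Companion proof file of `Literature/NumberTheory/Transcendental/ZilberField.lean`, discharging
the named fact `Literature.NumberTheory.Transcendental.hasCountableClosureProperty_complex` (Zilber 2005, Lemma 5.12; Kirby 2010,
Remark 3.4; Bays–Kirby 2018, Thm 1.8 with Lemma 10.6 and Prop. 10.7): the exponential-algebraic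
closure `ecl A` of a countable subset `A ⊆ ℂ` is countable.

## Proof

`Literature.ecl A` is the set of coordinates of solutions `x ∈ ℂⁿ` of Khovanskii systems
`f₁(x, eˣ) = ⋯ = fₙ(x, eˣ) = 0` (`fᵢ ∈ ℂ[X, Y]` with coefficients in the subring generated by
`A`) at which the Jacobian `det (∂ⱼ fᵢ(x, eˣ))` is nonzero (Kirby 2010, Def. 3.1–3.2). For a
fixed system the map `F(x) = (fᵢ(x, eˣ))ᵢ : ℂⁿ → ℂⁿ` is strictly differentiable with Fréchet
derivative given by the formal Jacobian matrix `Literature.Khovanskii.kjac x f`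
(`hasStrictFDerivAt_khovanskiiMap`), so at a solution with nonzero Jacobian `F` is a local
homeomorphism (inverse function theorem, `HasStrictFDerivAt.eventually_left_inverse`) and the
solution is isolated among all solutions. Hence the nondegenerate solution set of a fixed system
is discrete, so countable (`ℂⁿ` is second countable, hence hereditarily Lindelöf). There are
countably many systems (coefficients in the countable field `ℚ(A)`,
`MvPolynomial.cardinalMk_le_max`), so `ecl A` is countable. This is the argument of Zilber 2005,
Lemma 5.12 ("by the implicit function theorem ... the solutions are isolated points, hence there
are countably many") and of Kirby 2010, Remark 3.4 ("On `ℝ_exp` or `ℂ_exp`, there can only be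
countably many isolated zeros of a system of equations, so it follows that there are only
countably many exponentially algebraic numbers").

## Contents

* `Literature.khovanskiiMap f`, `Literature.khovanskiiSolutions f` — the map `x ↦ (fᵢ(x, eˣ))ᵢ` (evaluation at
  the point `Literature.Khovanskii.kpt x = (x, eˣ)`) and its set of nondegenerate zeros (nonvanishing of
  `det (Literature.Khovanskii.kjac x f)`), for `f : Fin n → ℂ[X, Y]`.
* `Literature.NumberTheory.Transcendental.hasStrictFDerivAt_mvPolynomial_eval`, `Literature.NumberTheory.Transcendental.hasStrictFDerivAt_kpt`,
  `Literature.NumberTheory.Transcendental.hasStrictFDerivAt_khovanskiiMap` — proved.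
* `Literature.NumberTheory.Transcendental.countable_khovanskiiSolutions` — nondegenerate solutions of one system are countable.
* `Literature.hasCountableClosureProperty_complex_holds : hasCountableClosureProperty_complex` — proved.
* `Literature.NumberTheory.Transcendental.ecl_eq_univ_of_exp_eq_one`,
  `Literature.NumberTheory.Transcendental.HasCountableClosureProperty.of_countable`,
  `Literature.NumberTheory.Transcendental.hasCountableClosureProperty_iff_finite` (the printed finite-parameter form,
  Kirby 2013 §2 axiom 5, via finite character `Kirby2010_ecl_finiteCharacter_holds`),
  `Literature.NumberTheory.Transcendental.not_hasCountableClosureProperty_of_exp_eq_one`,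
  `Literature.NumberTheory.Transcendental.exists_exponentialRing_not_hasCountableClosureProperty` — CCP is one of
  Zilber's *axioms*, a predicate on the exponential field and not a theorem about all of them:
  it holds in `ℂ_exp` (above) and in every countable exponential field, but for the trivial
  exponential `exp = 1` one has `ecl A = K` for every `A` (every element solves the Khovanskii
  system `e^{X₁} - 1 = 0`, formal Jacobian `e^{X₁} = 1`), so CCP fails on `(ℂ, exp = 1)`. Hence
  there is no unconditional `HasCountableClosureProperty_holds`; users keep
  `(h : HasCountableClosureProperty K)` as a hypothesis and feed it
  `hasCountableClosureProperty_complex_holds` for `ℂ_exp`.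

The point `kpt`, the exponential partial derivative `ePD` and the Jacobian `kjac` are those of
`EclPregeometryProofs.lean` (namespace `Literature.Khovanskii`); for `ι = Fin n` they are definitionally
the data in the body of `Literature.NumberTheory.Transcendental.ecl`.

## References

* B. Zilber, *Pseudo-exponentiation on algebraically closed fields of characteristic zero*,
  Ann. Pure Appl. Logic 132 (2005) 67–95, Lemma 5.12.
* J. Kirby, *Exponential algebraicity in exponential fields*, Bull. LMS 42 (2010) 879–890,
  arXiv:0810.4285: Def. 3.1–3.2, Remark 3.4.
* M. Bays, J. Kirby, *Pseudo-exponential maps, variants, and quasiminimality*, Algebra & Number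
  Theory 12 (2018) 493–549, arXiv:1512.04262: Thm 1.8, Lemma 10.6, Prop. 10.7.
* J. Kirby, *A note on the axioms for Zilber's pseudo-exponential fields*, Notre Dame J. Formal
  Logic 54 (2013) 509–520, arXiv:1006.0894: §2 axiom 5 (CCP, finite-parameter form), §2.4
  (`ecl` via polynomial exponential polynomials `p(X̄, e^X̄)`), §2.5 (`ℂ_exp` satisfies CCP:
  countably many Khovanskii systems over `ℚ(C)`, isolated solutions).
-/

noncomputable section

open MvPolynomial Set Filter Topology

namespace Literature.NumberTheory.Transcendental

/-! ### The Fréchet derivative of polynomial evaluation -/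

section MvPolyDeriv

variable {σ : Type*} [Fintype σ]

/-- Evaluation of a polynomial `p ∈ ℂ[Xₛ : s ∈ σ]` (finitely many variables) is strictly
differentiable on `ℂ^σ`, with derivative `h ↦ Σₖ (∂ₖ p)(y) hₖ` given by the formal partial
derivatives. [folklore] -/
theorem hasStrictFDerivAt_mvPolynomial_eval (p : MvPolynomial σ ℂ) (y : σ → ℂ) :
    HasStrictFDerivAt (fun z : σ → ℂ => eval z p)
      (∑ k : σ, eval y (pderiv k p) • ContinuousLinearMap.proj (R := ℂ) (φ := fun _ : σ => ℂ) k)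
      y := by
  classical
  induction p using MvPolynomial.induction_on with
  | C a =>
    refine ((hasStrictFDerivAt_const (a : ℂ) y).congr_fderiv ?_).congr_of_eventuallyEq
      (Eventually.of_forall fun z => by simp)
    ext h
    simp
  | add p q hp hq =>
    refine ((hp.add hq).congr_fderiv ?_).congr_of_eventuallyEq
      (Eventually.of_forall fun z => by simp)
    ext h
    simp only [map_add, add_apply, sum_apply,
      smul_apply, ContinuousLinearMap.proj_apply, smul_eq_mul, add_mul,
      Finset.sum_add_distrib]
  | mul_X p k hp =>
    have hX : HasStrictFDerivAt (fun z : σ → ℂ => z k)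
        (ContinuousLinearMap.proj (R := ℂ) (φ := fun _ : σ => ℂ) k) y :=
      (ContinuousLinearMap.proj (R := ℂ) (φ := fun _ : σ => ℂ) k).hasStrictFDerivAt
    refine ((hp.mul hX).congr_fderiv ?_).congr_of_eventuallyEq
      (Eventually.of_forall fun z => by simp)
    ext h
    simp only [Derivation.leibniz, pderiv_X, smul_eq_mul, map_add, map_mul, eval_X,
      add_apply, smul_apply,
      sum_apply, ContinuousLinearMap.proj_apply]
    simp only [add_mul, Finset.sum_add_distrib]
    congr 1
    · rw [Finset.sum_eq_single k, Pi.single_eq_same, map_one, mul_one]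
      · intro x _ hxk
        rw [Pi.single_eq_of_ne (Ne.symm hxk), map_zero, mul_zero, zero_mul]
      · intro hk; exact absurd (Finset.mem_univ k) hk
    · rw [Finset.mul_sum]
      exact Finset.sum_congr rfl fun x _ => by ring
end MvPolyDeriv

/-! ### Khovanskii systems over `ℂ` -/

section Khovanskii

open Khovanskii

variable {n : ℕ}

/-- The map `F(x) = (f₁(x, eˣ), …, fₙ(x, eˣ))` of a system `f` of `n` exponential polynomials
in `n` variables, i.e. evaluation at the point `Khovanskii.kpt x = (x, eˣ)` (Kirby 2010,
Def. 3.1; Zilber 2005 §5). [cite: Kirby2010, Def. 3.1] -/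
def khovanskiiMap (f : Fin n → MvPolynomial (Fin n ⊕ Fin n) ℂ) (x : Fin n → ℂ) : Fin n → ℂ :=
  fun i => eval (kpt x) (f i)

/-- The set of *nondegenerate* solutions of a Khovanskii system: `F(x) = 0` with nonzero
Jacobian `det (Khovanskii.kjac x f) ≠ 0` (Kirby 2010, Def. 3.1–3.2: these are the solutions whose
coordinates make up `ecl`). [cite: Kirby2010, Def. 3.1–3.2] -/
def khovanskiiSolutions (f : Fin n → MvPolynomial (Fin n ⊕ Fin n) ℂ) : Set (Fin n → ℂ) :=
  {x | khovanskiiMap f x = 0 ∧ (kjac x f).det ≠ 0}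

/-- The derivative of `x ↦ (x, eˣ)`: `h ↦ (h, (e^{xⱼ} hⱼ)ⱼ)`. [folklore] -/
def expPointDeriv (x : Fin n → ℂ) : (Fin n → ℂ) →L[ℂ] (Fin n ⊕ Fin n → ℂ) :=
  ContinuousLinearMap.pi (Sum.elim
    (fun j => ContinuousLinearMap.proj (R := ℂ) (φ := fun _ : Fin n => ℂ) j)
    (fun j => Complex.exp (x j) • ContinuousLinearMap.proj (R := ℂ) (φ := fun _ : Fin n => ℂ) j))

/-- `x ↦ (x, eˣ) = Khovanskii.kpt x` is strictly differentiable with derivative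
`expPointDeriv x` (from `Complex.hasStrictDerivAt_exp`). [folklore] -/
theorem hasStrictFDerivAt_kpt (x : Fin n → ℂ) :
    HasStrictFDerivAt (kpt (K := ℂ) (ι := Fin n)) (expPointDeriv x) x := by
  rw [expPointDeriv, hasStrictFDerivAt_pi]
  intro k
  rcases k with j | j
  · exact (ContinuousLinearMap.proj (R := ℂ) (φ := fun _ : Fin n => ℂ) j).hasStrictFDerivAt
  · exact (Complex.hasStrictDerivAt_exp (x j)).comp_hasStrictFDerivAt x
      (ContinuousLinearMap.proj (R := ℂ) (φ := fun _ : Fin n => ℂ) j).hasStrictFDerivAt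

/-- **The Jacobian of a Khovanskii map is its formal Jacobian**: `F = (fᵢ(x, eˣ))ᵢ` is strictly
differentiable at every `x ∈ ℂⁿ` with Fréchet derivative the linear map of the matrix
`Khovanskii.kjac x f = ((∂ⱼ + Yⱼ∂_{n+j}) fᵢ (x, eˣ))ᵢⱼ` (chain rule; Kirby 2010 §3, Zilber 2005
Lemma 5.12). [cite: Zilber2005, Lemma 5.12] -/
theorem hasStrictFDerivAt_khovanskiiMap (f : Fin n → MvPolynomial (Fin n ⊕ Fin n) ℂ)
    (x : Fin n → ℂ) :
    HasStrictFDerivAt (khovanskiiMap f)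
      (LinearMap.toContinuousLinearMap (Matrix.toLin' (kjac x f))) x := by
  have hcomp : ∀ i, HasStrictFDerivAt (fun z : Fin n → ℂ => eval (kpt z) (f i))
      ((∑ k : Fin n ⊕ Fin n, eval (kpt x) (pderiv k (f i)) •
        ContinuousLinearMap.proj (R := ℂ) (φ := fun _ : Fin n ⊕ Fin n => ℂ) k).comp
        (expPointDeriv x)) x :=
    fun i => (hasStrictFDerivAt_mvPolynomial_eval (f i) (kpt x)).comp x
      (hasStrictFDerivAt_kpt x)
  have hpi := hasStrictFDerivAt_pi.2 hcomp
  refine hpi.congr_fderiv ?_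
  ext h i
  simp only [ContinuousLinearMap.pi_apply, ContinuousLinearMap.comp_apply, add_apply,
    sum_apply, smul_apply, ContinuousLinearMap.proj_apply, smul_eq_mul,
    LinearMap.coe_toContinuousLinearMap', Matrix.toLin'_apply, Matrix.mulVec, dotProduct,
    kjac, Matrix.of_apply, ePD, map_add, map_mul, eval_X, expPointDeriv,
    Fintype.sum_sum_type, Sum.elim_inl, Sum.elim_inr, kpt_inr,
    Literature.ModelTheory.ExponentialFields.ExponentialRing.complex_exp_eq]
  rw [← Finset.sum_add_distrib]
  exact Finset.sum_congr rfl fun j _ => by ring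

/-- **Nondegenerate solutions of a Khovanskii system are isolated, hence countably many**
(Zilber 2005, Lemma 5.12: "by the implicit function theorem the solutions are isolated"; Kirby
2010, Remark 3.4). At a solution with invertible Jacobian the map `F` is a local homeomorphism
(inverse function theorem), so no other solution is nearby; a discrete subset of `ℂⁿ` is
countable. [cite: Zilber2005, Lemma 5.12] [cite: Kirby2010, Remark 3.4] -/
theorem countable_khovanskiiSolutions (f : Fin n → MvPolynomial (Fin n ⊕ Fin n) ℂ) :
    (khovanskiiSolutions f).Countable := by
  apply (HereditarilyLindelofSpace.isLindelof _).countable_of_isDiscrete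
  rw [isDiscrete_iff_nhdsNE]
  rintro x ⟨hx0, hdet⟩
  set A := LinearMap.toContinuousLinearMap (Matrix.toLin' (kjac x f)) with hA
  have hAdet : A.det ≠ 0 := by
    rw [hA, ContinuousLinearMap.det, LinearMap.coe_toContinuousLinearMap, LinearMap.det_toLin']
    exact hdet
  have hF : HasStrictFDerivAt (khovanskiiMap f)
      ((A.toContinuousLinearEquivOfDetNeZero hAdet : (Fin n → ℂ) ≃L[ℂ] (Fin n → ℂ)) :
        (Fin n → ℂ) →L[ℂ] (Fin n → ℂ)) x := by
    rw [ContinuousLinearMap.coe_toContinuousLinearEquivOfDetNeZero]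
    exact hasStrictFDerivAt_khovanskiiMap f x
  rw [Filter.inf_principal_eq_bot, mem_nhdsWithin_iff_eventually]
  filter_upwards [hF.eventually_left_inverse] with y hy hne hyS
  apply hne
  have hx : hF.localInverse _ _ _ (khovanskiiMap f x) = x := hF.localInverse_apply_image
  rw [Set.mem_singleton_iff]
  calc y = hF.localInverse _ _ _ (khovanskiiMap f y) := hy.symm
    _ = hF.localInverse _ _ _ 0 := by rw [hyS.1]
    _ = hF.localInverse _ _ _ (khovanskiiMap f x) := by rw [hx0]
    _ = x := hx

end Khovanskii

/-! ### The countable closure property -/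

/-- Polynomials over `ℂ` in finitely many variables all of whose coefficients lie in a countable
subfield form a countable set (`MvPolynomial.cardinalMk_le_max`). [folklore] -/
theorem countable_setOf_coeff_mem {σ : Type} [Finite σ] (K : Subfield ℂ)
    (hK : (K : Set ℂ).Countable) :
    {p : MvPolynomial σ ℂ | ∀ m, p.coeff m ∈ K}.Countable := by
  have hKc : Countable K := hK.to_subtype
  have hcount : Countable (MvPolynomial σ K) := by
    rw [← Cardinal.mk_le_aleph0_iff]
    refine (MvPolynomial.cardinalMk_le_max).trans ?_
    simp only [max_le_iff, le_refl, and_true]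
    exact ⟨Cardinal.mk_le_aleph0, Cardinal.mk_le_aleph0⟩
  refine (Set.countable_range (MvPolynomial.map K.subtype)).mono fun p hp => ?_
  rw [MvPolynomial.mem_range_map_iff_coeffs_subset]
  intro c hc
  obtain ⟨m, -, rfl⟩ := MvPolynomial.mem_coeffs_iff.1 hc
  exact ⟨⟨p.coeff m, hp m⟩, rfl⟩

/-- **`ℂ_exp` has the countable closure property** (Zilber 2005, Lemma 5.12; Kirby 2010,
Remark 3.4; Bays–Kirby 2018, Lemma 10.6 / Prop. 10.7): discharge of the named fact
`Literature.NumberTheory.Transcendental.hasCountableClosureProperty_complex`. For countable `A ⊆ ℂ` there are countably many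
Khovanskii systems with coefficients in `ℤ[A] ⊆ ℚ(A)` (`countable_setOf_coeff_mem`), each with
countably many nondegenerate solutions (`countable_khovanskiiSolutions`), and `ecl A` is the set
of their coordinates. [cite: Zilber2005, Lemma 5.12] [cite: Kirby2010, Remark 3.4] -/
theorem hasCountableClosureProperty_complex_holds : hasCountableClosureProperty_complex := by
  intro A hA
  set K : Subfield ℂ := Subfield.closure A with hKdef
  have hK : (K : Set ℂ).Countable := by
    rw [← Cardinal.le_aleph0_iff_set_countable]
    refine (Subfield.cardinalMk_closure_le_max A).trans ?_
    exact max_le (Cardinal.le_aleph0_iff_set_countable.2 hA) le_rfl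
  have hRK : Subring.closure A ≤ K.toSubring := Subring.closure_le.2 Subfield.subset_closure
  -- the countable family of admissible systems
  let Sys : ∀ n : ℕ, Set (Fin n → MvPolynomial (Fin n ⊕ Fin n) ℂ) :=
    fun n => {f | ∀ i, f i ∈ {p : MvPolynomial (Fin n ⊕ Fin n) ℂ | ∀ m, p.coeff m ∈ K}}
  have hSys : ∀ n, (Sys n).Countable := fun n =>
    Set.countable_pi fun _ => countable_setOf_coeff_mem K hK
  have hsub : ecl A ⊆ ⋃ n : ℕ, ⋃ f ∈ Sys n, ⋃ i : Fin n,
      (fun x : Fin n → ℂ => x i) '' khovanskiiSolutions f := by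
    rintro a ⟨n, x, f, ⟨i, hi⟩, hcoeff, heval, hdet⟩
    refine Set.mem_iUnion.2 ⟨n, Set.mem_iUnion₂.2 ⟨f, fun i m => hRK (hcoeff i m),
      Set.mem_iUnion.2 ⟨i, x, ⟨?_, hdet⟩, hi⟩⟩⟩
    funext j
    exact heval j
  refine Set.Countable.mono hsub (Set.countable_iUnion fun n => ?_)
  exact (hSys n).biUnion fun f _ => Set.countable_iUnion fun i =>
    (countable_khovanskiiSolutions f).image _

/-! ### CCP is an axiom, not a theorem: the trivial exponential -/

section Axiom

variable {K : Type*} [Field K] [Literature.ModelTheory.ExponentialFields.ExponentialRing K]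

/-- **With the trivial exponential every element is exponentially algebraic over `∅`.** If
`exp = 1` on `K`, every `a ∈ K` solves the one-variable Khovanskii system `Y₁ - 1 = 0`, i.e.
`e^{x₁} - 1 = 0`, with coefficients in `ℤ`, and its *formal* Jacobian
`(∂/∂X₁ + Y₁ ∂/∂Y₁)(Y₁ - 1) = Y₁` evaluates to `e^{a} = 1 ≠ 0` (Kirby 2010, Def. 3.1–3.2: the
Jacobian of a Khovanskii system is the formal one, "purely algebraic, so we do not need any
topology to make sense of it"). Hence `ecl A = K` for every `A ⊆ K`. [folklore] -/
theorem ecl_eq_univ_of_exp_eq_one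
    (h : ∀ x : K, Literature.ModelTheory.ExponentialFields.ExponentialRing.exp x = 1) (A : Set K) :
    ecl A = Set.univ := by
  classical
  refine Set.eq_univ_of_forall fun a => ?_
  refine ⟨1, fun _ => a, fun _ => X (Sum.inr 0) - 1, ⟨0, rfl⟩, ?_, ?_, ?_⟩
  · intro i m
    rw [coeff_sub, coeff_X, coeff_one]
    refine sub_mem ?_ ?_
    · split_ifs
      exacts [one_mem _, zero_mem _]
    · split_ifs
      exacts [one_mem _, zero_mem _]
  · intro i
    simp [h]
  · have hj : ∀ j : Fin 1,
        eval (Sum.elim (fun _ => a) (Literature.ModelTheory.ExponentialFields.ExponentialRing.exp ∘ fun _ => a))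
          (expPDeriv j (X (Sum.inr 0) - 1) : MvPolynomial (Fin 1 ⊕ Fin 1) K) = 1 := by
      intro j
      simp [expPDeriv, Subsingleton.elim j 0, pderiv_X, h]
    rw [Matrix.det_unique, Matrix.of_apply, hj]
    exact one_ne_zero

/-- Countable exponential fields have the countable closure property (vacuously: every subset is
countable). In particular CCP says nothing about Zilber's countable pseudo-exponential fields; its
role is in uncountable cardinalities (Zilber 2005, §5). [folklore] -/
theorem HasCountableClosureProperty.of_countable [Countable K] : HasCountableClosureProperty K :=
  fun _ _ => Set.to_countable _

/-- **CCP in its printed, finite-parameter form.** Zilber 2005 §1 and Kirby 2013, §2, axiom 5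
state CCP as "for each finite subset `C` of `F`, the exponential algebraic closure `ecl^F(C)` of
`C` in `F` is countable"; this is equivalent to `HasCountableClosureProperty K` (countable
parameter sets) because `ecl` has finite character (Kirby 2010, Lemma 3.3, discharged as
`Kirby2010_ecl_finiteCharacter_holds`): the closure of a countable set `A` is the union of the
closures of the countably many finite subsets of `A` (`Set.countable_setOf_finite_subset`).
[cite: Kirby2013, §2, axiom 5 (Countable Closure Property)] [cite: Kirby2010, Lemma 3.3] -/
theorem hasCountableClosureProperty_iff_finite :
    HasCountableClosureProperty K ↔ ∀ A : Set K, A.Finite → (ecl A).Countable := by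
  refine ⟨fun h A hA => h A hA.countable, fun h A hA => ?_⟩
  have hS : {A₀ : Finset K | (↑A₀ : Set K) ⊆ A}.Countable := by
    refine ((Set.countable_setOf_finite_subset hA).preimage Finset.coe_injective).mono ?_
    intro A₀ hA₀
    simp only [Set.mem_preimage, Set.mem_setOf_eq] at hA₀ ⊢
    exact ⟨A₀.finite_toSet, hA₀⟩
  rw [Kirby2010_ecl_finiteCharacter_holds K A]
  exact hS.biUnion fun A₀ _ => h _ A₀.finite_toSet

/-- **CCP fails for the trivial exponential on an uncountable field**: by
`ecl_eq_univ_of_exp_eq_one`, `ecl ∅ = K` is uncountable. So the countable closure property is a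
genuine axiom on the exponential field (Zilber 2005, §1 and §5, axiom CCP), not a consequence of the
E-field axioms; what the literature proves is CCP for `ℂ_exp` (Zilber 2005, Lemma 5.12; Kirby
2010, Remark 3.4), which is `hasCountableClosureProperty_complex_holds` above. [folklore] -/
theorem not_hasCountableClosureProperty_of_exp_eq_one
    (h : ∀ x : K, Literature.ModelTheory.ExponentialFields.ExponentialRing.exp x = 1)
    (hK : ¬ (Set.univ : Set K).Countable) : ¬ HasCountableClosureProperty K :=
  fun hccp => hK (ecl_eq_univ_of_exp_eq_one h ∅ ▸ hccp ∅ Set.countable_empty)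

/-- Consequently there is no unconditional `HasCountableClosureProperty_holds`: the field `ℂ` with
the *trivial* exponential `exp = 1` (not `Complex.exp`) is an uncountable exponential field of
characteristic zero without the countable closure property (`not_countable_complex`), while
`ℂ_exp = (ℂ, Complex.exp)` has it (`hasCountableClosureProperty_complex_holds`). [folklore] -/
theorem exists_exponentialRing_not_hasCountableClosureProperty :
    ∃ E : Literature.ModelTheory.ExponentialFields.ExponentialRing ℂ,
      ¬ @HasCountableClosureProperty ℂ _ E :=
  ⟨⟨fun _ => 1, rfl, fun _ _ => (one_mul 1).symm⟩,
    @not_hasCountableClosureProperty_of_exp_eq_one ℂ _ ⟨fun _ => 1, rfl, fun _ _ => (one_mul 1).symm⟩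
      (fun _ => rfl) not_countable_complex⟩

end Axiom

end Literature.NumberTheory.Transcendental
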